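/-
Copyright (c) 2026. All rights reserved.
Released under Apache 2.0 license as described in the file LICENSE.
Authors: abc-iut cell, prover seat abc-iut-L4-d2 (gen 7).
-/
import Mathlib.Data.Real.Basic
import Literature.AnabelianGeometry.AbsoluteAnabelian.GaloisTheatersNumberFieldShadowTFPairsModel
import Literature.AnabelianGeometry.AbsoluteAnabelian.GaloisTheatersNumberFieldShadowTFPairsCor52iii
import Literature.AnabelianGeometry.AbsoluteAnabelian.GaloisTheatersNumberFieldShadowTFPairsCor52iv
import Literature.AnabelianGeometry.AbsoluteAnabelian.PanalocalTPairs
import HarnessLib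

/-!
# [AbsTopIII] Cor 5.2 (iii), (iv) and (vii)-faithfulness PROVED at the `TF`-shadow vocabulary with the print-shape
# MLF-Galois-pair predicate; Cor 5.2 (vii)-faithfulness REFUTED at the group-only predicate

S. Mochizuki, *Topics in absolute anabelian geometry III* [MochizukiAbsTopIII2015], Cor 5.2 (iii)/(iv) pp. 119–120, Cor 5.2 (vii)
p. 121 ("natural functors `Th✠ → An✠[Th✠_T] → Th✠_T → Th✠` … all of which are equivalences of categories"; proof, as a
gloss: the `T`-isomorphisms of a morphism of panalocal `T`-pairs are determined — Prop 3.2 (ii), (iv) at nonarchimedean `v`,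
"`κ_v`" at archimedean `v`), Def 3.1 (ii) p. 67, Def 5.1 (vi) p. 118.  (v2: the Cor 5.2 (vii) fragment re-quoted verbatim —
referee abc-iut-ref-l L14-n5 site 3; theorems byte-identical to v1 p493670.)

PROOF-ONLY companion (no `def` / `instance` / `structure`) of `GaloisTheatersNumberFieldShadowTFPairsModel.lean` (abc-iut-L4-d2 g7:
`fieldShadowVocabulary' F` = the `TF`-shadow vocabulary with `IsMLFGaloisPair := IsShadowMLFGaloisTFPair`, "isomorphic to a model
pair `(U ↷ ℚ̄)`"):

* Cor 5.2 (iii)/(iv) at the primed vocabulary — `referencePairIsoUnique_fieldShadow'` (**F-0189**),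
  `tPairHomDeterminedByTheaterHom_fieldShadow'` (**F-0191**), `tPairIsoCanonical_fieldShadow'` (**F-0192**),
  `tPairEAHomExtends_fieldShadow'` (**F-0190**) — transferred from the unprimed vocabulary (the primed predicate refines the
  unprimed one and none of the four statements reads the predicate otherwise) resp. by descent;
* **`panalocalTPairHomDetermined_fieldShadow'` — Cor 5.2 (vii), faithfulness of `Th✠_T → Th✠` (F-3089 `PanalocalTPairHomDetermined`),
  PROVED at `(context F, fieldShadowVocabulary' F)`**: in a morphism of panalocal `TF`-pairs the nonarchimedean `φ_v` are pinned
  by Prop 3.2 (iv) at the shadow (`IsShadowMLFGaloisTFPair.eq_refl_of_equivariant` applied to the SOURCE pair, an MLF-Galois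
  `TF`-pair of the shadow by the vocabulary's predicate) and the archimedean `φ_v` by injectivity of the Kummer embedding and of
  `A_{X₁} ≅ A_{X₂}`;
* **`not_panalocalTPairHomDetermined_fieldShadow` — the same row is FALSE at the UNPRIMED vocabulary** `fieldShadowVocabulary F`
  (p491073), whose MLF-pair predicate is group-theoretic only: a panalocal `TF`-pair with TRIVIAL actions on `ℚ̄` qualifies, and
  then complex conjugation is a second endomorphism over the identity of the theater.  So the print-shape predicate is exactly
  what Cor 5.2 (vii) needs — recorded, not hidden.

HONEST LABEL: shadow (`Δ = 1`), algebraic parts of the completions, stub cyclotomes; Cor 5.2 (vii)'s other two clauses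
(`PanalocalTPairIsoCanonical`, `PanalocalTheaterHomLifts`) are NOT addressed (they need a group-theoretic RECONSTRUCTION of `ℚ̄`
from `D`, resp. rigidity of arbitrary open injections between decomposition groups — not available at the shadow).  NOT the
genuine `(R, W)` (E-L4-13).  Nothing here bears on [IUTchIII] Cor. 3.12 or takes a side; typed ≠ proved.
-/

noncomputable section

open scoped Pointwise Topology
open CategoryTheory NumberField Field

namespace Literature.AnabelianGeometry.AbsoluteAnabelian

namespace NumberFieldShadow

variable (F : Type) [Field F] [NumberField F]

/-! ### Cor 5.2 (iii) at the primed vocabulary (transfer) -/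

/-- **F-0189 at the primed `TF`-shadow vocabulary**: the reference isomorphisms of a global `TF`-pair are unique (transfer:
forget the primed pair to an unprimed one — the reference conditions do not read the MLF-pair predicate).
[cite: MochizukiAbsTopIII2015, Cor 5.2 (iii) p.119] -/
theorem referencePairIsoUnique_fieldShadow' : ReferencePairIsoUnique (fieldShadowVocabulary' F) tf_ne_tlg := by
  intro P ψV hψV hnon harc ψ ψ' ψnon ψnon' ψarc ψarc' href href'
  exact referencePairIsoUnique_fieldShadow F
    { theater := P.theater, M := P.M, act := P.act, isCont := P.isCont, Mnon := P.Mnon, Marc := P.Marc,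
      actNon := P.actNon, isMLF := fun v => IsShadowMLFGaloisTFPair.isMLFGaloisType (P.isMLF v),
      kummer := P.kummer, isAutHol := P.isAutHol, ρnon := P.ρnon, ρarc := P.ρarc,
      exists_reference := P.exists_reference }
    ψV hψV hnon harc ψ ψ' ψnon ψnon' ψarc ψarc' href href'

/-- **F-0191 at the primed `TF`-shadow vocabulary**: `φ⊚`, `{φ_v}` of a morphism of global `TF`-pairs are determined by `φ_{V⊚}`
(transfer through the forgetful map on pairs and morphisms). [cite: MochizukiAbsTopIII2015, Cor 5.2 (iii) p.119] -/
theorem tPairHomDeterminedByTheaterHom_fieldShadow' :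
    TPairHomDeterminedByTheaterHom (fieldShadowVocabulary' F) tf_ne_tlg := by
  intro P₁ P₂ φ φ' hV
  let Q₁ : GlobalTPair (fieldShadowVocabulary F) :=
    { theater := P₁.theater, M := P₁.M, act := P₁.act, isCont := P₁.isCont, Mnon := P₁.Mnon, Marc := P₁.Marc,
      actNon := P₁.actNon, isMLF := fun v => IsShadowMLFGaloisTFPair.isMLFGaloisType (P₁.isMLF v),
      kummer := P₁.kummer, isAutHol := P₁.isAutHol, ρnon := P₁.ρnon, ρarc := P₁.ρarc,
      exists_reference := P₁.exists_reference }
  let Q₂ : GlobalTPair (fieldShadowVocabulary F) :=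
    { theater := P₂.theater, M := P₂.M, act := P₂.act, isCont := P₂.isCont, Mnon := P₂.Mnon, Marc := P₂.Marc,
      actNon := P₂.actNon, isMLF := fun v => IsShadowMLFGaloisTFPair.isMLFGaloisType (P₂.isMLF v),
      kummer := P₂.kummer, isAutHol := P₂.isAutHol, ρnon := P₂.ρnon, ρarc := P₂.ρarc,
      exists_reference := P₂.exists_reference }
  let ξ : GlobalTPair.Hom (fieldShadowVocabulary F) Q₁ Q₂ :=
    { φV := φ.φV, φM := φ.φM, φM_equivariant := φ.φM_equivariant, non_mem := φ.non_mem, arc_mem := φ.arc_mem,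
      φnon := φ.φnon, φnon_equivariant := φ.φnon_equivariant, φarc := φ.φarc, φarc_kummer := φ.φarc_kummer,
      ρnon_comm := φ.ρnon_comm, ρarc_comm := φ.ρarc_comm }
  let ξ' : GlobalTPair.Hom (fieldShadowVocabulary F) Q₁ Q₂ :=
    { φV := φ'.φV, φM := φ'.φM, φM_equivariant := φ'.φM_equivariant, non_mem := φ'.non_mem, arc_mem := φ'.arc_mem,
      φnon := φ'.φnon, φnon_equivariant := φ'.φnon_equivariant, φarc := φ'.φarc, φarc_kummer := φ'.φarc_kummer,
      ρnon_comm := φ'.ρnon_comm, ρarc_comm := φ'.ρarc_comm }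
  exact tPairHomDeterminedByTheaterHom_fieldShadow F Q₁ Q₂ ξ ξ' hV

/-! ### Cor 5.2 (iv) at the primed vocabulary -/

/-- The primed MLF-pair predicate DESCENDS along isomorphisms of pairs (Def 3.1 (ii) is "isomorphic to a model").
[cite: MochizukiAbsTopIII2015, Def 3.1 (ii) p.67] -/
theorem isMLFGaloisPair_descends_fieldShadow' {D D' : ProfiniteGrp.{0}} {M N : (fieldShadowVocabulary' F).LocObj}
    (a : D →* Aut M) (b : D' →* Aut N) (e : D ≃ₜ* D') (ψ : M ≅ N)
    (h : ∀ g, (a g).hom ≫ ψ.hom = ψ.hom ≫ (b (e g)).hom)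
    (hb : (fieldShadowVocabulary' F).IsMLFGaloisPair b) : (fieldShadowVocabulary' F).IsMLFGaloisPair a :=
  IsShadowMLFGaloisTFPair.of_iso hb e ψ h

/-- **F-0192 at the primed `TF`-shadow vocabulary**: every global `TF`-pair is isomorphic over `𝟙_Π` to the canonical one
(descent). [cite: MochizukiAbsTopIII2015, Cor 5.2 (iv) p.120] -/
theorem tPairIsoCanonical_fieldShadow' : TPairIsoCanonical (fieldShadowVocabulary' F) tf_ne_tlg :=
  (fieldShadowVocabulary' F).tPairIsoCanonical_of_descent tf_ne_tlg (context_mapKNF_id F)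
    (fun a b ψ h hb => isContGlob_descends_fieldShadow F a b ψ h hb)
    (fun a b e ψ h hb => isMLFGaloisPair_descends_fieldShadow' F a b e ψ h hb)
    (fun i ψ k hk => isAutHolPair_descends_fieldShadow F i ψ k hk)

/-- **F-0190 at the primed `TF`-shadow vocabulary**: morphisms of `EA⊚` between admissibles extend to the canonical global
`TF`-pairs (transfer of the unprimed extension: the canonical pairs have the same data). [cite: MochizukiAbsTopIII2015, Cor 5.2 (iv) p.120] -/
theorem tPairEAHomExtends_fieldShadow' : TPairEAHomExtends (fieldShadowVocabulary' F) tf_ne_tlg := by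
  intro E₁ E₂ h₁ h₂ hc₁ hM₁ hA₁ hc₂ hM₂ hA₂ f hf
  obtain ⟨φ, hφ⟩ := tPairEAHomExtends_fieldShadow F E₁ E₂ h₁ h₂ hc₁
    (fun v => IsShadowMLFGaloisTFPair.isMLFGaloisType (hM₁ v)) hA₁ hc₂
    (fun v => IsShadowMLFGaloisTFPair.isMLFGaloisType (hM₂ v)) hA₂ f hf
  exact ⟨{ φV := φ.φV, φM := φ.φM, φM_equivariant := φ.φM_equivariant, non_mem := φ.non_mem, arc_mem := φ.arc_mem,
           φnon := φ.φnon, φnon_equivariant := φ.φnon_equivariant, φarc := φ.φarc, φarc_kummer := φ.φarc_kummer,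
           ρnon_comm := φ.ρnon_comm, ρarc_comm := φ.ρarc_comm }, hφ⟩

/-! ### Cor 5.2 (vii), faithfulness of `Th✠_T → Th✠`, at the primed vocabulary -/

/-- **Cor 5.2 (vii), faithfulness (F-3089 `PanalocalTPairHomDetermined`), PROVED at the primed `TF`-shadow vocabulary**: a
morphism of panalocal `TF`-pairs over `NumberFieldShadow.context F` is determined by its morphism of panalocal Galois-theaters —
at nonarchimedean `v`, `φ_v ∘ φ'_v⁻¹` is an equivariant automorphism of the SOURCE pair `((Π₁)_v ↷ (M₁)_v)`, an MLF-Galois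
`TF`-pair of the shadow, hence trivial (Prop 3.2 (iv), `IsShadowMLFGaloisTFPair.eq_refl_of_equivariant`); at archimedean `v`,
both `φ_v`, `φ'_v` transport the injective Kummer embedding of `(M₁)_v` along the SAME `(X₁)_v ≅ (X₂)_v` to the Kummer embedding
of `(M₂)_v`, so they agree ("`κ_v`", proof of Cor 5.2, p. 121). [cite: MochizukiAbsTopIII2015, Cor 5.2 (vii) p.121] -/
theorem panalocalTPairHomDetermined_fieldShadow' :
    PanalocalTPairHomDetermined (fieldShadowVocabulary' F) tf_ne_tlg := by
  intro Q₁ Q₂ φ φ' hV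
  obtain ⟨φV, φn, hne, φa, hak⟩ := φ
  obtain ⟨φV', φn', hne', φa', hak'⟩ := φ'
  cases hV
  -- nonarchimedean components: Prop 3.2 (iv) at the shadow, on the source pair
  have h1 : φn = φn' := by
    funext v
    refine iso_eq_of_conj_trans_symm_eq_refl (Iso.refl _) (φn v) (φn' v) ?_
    rw [Iso.refl_trans, Iso.refl_symm, Iso.trans_refl]
    refine IsShadowMLFGaloisTFPair.eq_refl_of_equivariant (Q₁.data.isMLF v) _ fun g => ?_
    refine CommRingCat.hom_ext (RingHom.ext fun x => ?_)
    change (φn' v).inv.hom ((φn v).hom.hom (((Q₁.data.actNon v) g).hom.hom x)) =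
      ((Q₁.data.actNon v) g).hom.hom ((φn' v).inv.hom ((φn v).hom.hom x))
    rw [iso_hom_conj (φn v) _ _ (hne v g), iso_inv_conj (φn' v) _ _ (hne' v g)]
  -- archimedean components: injectivity of the Kummer embedding and of `A_{X₁} ≅ A_{X₂}`
  have h2 : φa = φa' := by
    funext v
    have hk₀ : kummerTransportTF (φV.archIso v) (φa v)
        (show (show CommRingCat.{0} from Q₁.data.Marc v) →+* (Q₁.theater.X v).fieldA from Q₁.data.kummer v) =
        (show (show CommRingCat.{0} from Q₂.data.Marc ⟨φV.φV v, φV.arc_mem v⟩) →+*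
          (Q₂.theater.X ⟨φV.φV v, φV.arc_mem v⟩).fieldA from Q₂.data.kummer ⟨φV.φV v, φV.arc_mem v⟩) := hak v
    have hk₀' : kummerTransportTF (φV.archIso v) (φa' v)
        (show (show CommRingCat.{0} from Q₁.data.Marc v) →+* (Q₁.theater.X v).fieldA from Q₁.data.kummer v) =
        (show (show CommRingCat.{0} from Q₂.data.Marc ⟨φV.φV v, φV.arc_mem v⟩) →+*
          (Q₂.theater.X ⟨φV.φV v, φV.arc_mem v⟩).fieldA from Q₂.data.kummer ⟨φV.φV v, φV.arc_mem v⟩) := hak' v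
    have hinjk : Function.Injective
        (show (show CommRingCat.{0} from Q₁.data.Marc v) →+* (Q₁.theater.X v).fieldA from Q₁.data.kummer v) :=
      Q₁.data.isAutHol v
    refine iso_eq_of_forall_inv_apply fun s => hinjk ((φV.archIso v).fieldIso.injective ?_)
    have e1 := congrArg (fun k => k s) hk₀
    have e2 := congrArg (fun k => k s) hk₀'
    exact e1.trans e2.symm
  subst h1 h2
  rfl

/-! ### Cor 5.2 (vii)-faithfulness FAILS at the group-only predicate -/

/-- **`PanalocalTPairHomDetermined` is FALSE at the unprimed `TF`-shadow vocabulary** `fieldShadowVocabulary F` (p491073), whose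
MLF-Galois-pair predicate is the group-theoretic `IsMLFGaloisType D` only: over a panalocalization `V✠` of `V⊚(E_F)` take the
panalocal `TF`-pair with local data `ℚ̄` and TRIVIAL actions (it qualifies: the groups of `V✠` are of MLF type), and Kummer
embeddings transported from `κ_{ell,v}`; then the identity AND complex conjugation on the nonarchimedean data are two morphisms
over the identity of `V✠`.  (Refuted-as-typed at an instance; the print-shape predicate of the primed vocabulary repairs it,
`panalocalTPairHomDetermined_fieldShadow'`.) [cite: MochizukiAbsTopIII2015, Cor 5.2 (vii) p.121] -/
theorem not_panalocalTPairHomDetermined_fieldShadow :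
    ¬ PanalocalTPairHomDetermined (fieldShadowVocabulary F) tf_ne_tlg := by
  intro h
  -- a panalocalization `V✠` of the theater `V⊚(E_F)`
  obtain ⟨V, E, hE, ψ, href⟩ :
      ∃ (V : PanalocalGaloisTheater (context F)) (E : FundamentalExtension.{0}) (_ : (context F).IsAdmissible E)
        (ψ : (context F).ProValModAut E ≃ V.V), IsPanalocalReferenceFor (context F) V.generic V.non V.arc V.grp V.X E ψ := by
    obtain ⟨V, -⟩ := panalocalizationExists_context F (extension F) (isAdmissible_extension F)
    obtain ⟨E, hE, ψ, hψ⟩ := V.exists_reference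
    exact ⟨V, E, hE, ψ, hψ⟩
  obtain ⟨hgen, hnon, harc, hgrp, hX⟩ := href
  -- its groups are of MLF type; its orbispaces carry Kummer embeddings of `ℚ̄`
  have hMLF : ∀ v : V.non, IsMLFGaloisType (V.grp v) := fun v => by
    obtain ⟨vl, hvl, -, ⟨e⟩⟩ := hgrp v
    exact IsMLFGaloisType.of_continuousMulEquiv (isMLFGaloisType_decomp_context F hE vl hvl _) e
  have hK : ∀ v : V.arc, ∃ κ : AlgebraicClosure ℚ →+* (V.X v).fieldA, Function.Injective κ := fun v => by
    obtain ⟨vl, -, ⟨x⟩⟩ := hX v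
    exact ⟨x.fieldIso.symm.toRingHom.comp (contextKappa E vl), (x.fieldIso.symm.injective).comp (contextKappa E vl).injective⟩
  choose κ hκ using hK
  -- the panalocal `TF`-pair with trivial actions
  let Q : PanalocalTPair (fieldShadowVocabulary F) :=
    { theater := V
      data :=
        { Mnon := fun _ => CommRingCat.of (AlgebraicClosure ℚ)
          actNon := fun _ => 1
          isMLF := fun v => hMLF v
          Marc := fun _ => CommRingCat.of (AlgebraicClosure ℚ)
          kummer := fun v => κ v
          isAutHol := fun v => hκ v } }
  -- a nonarchimedean index exists
  have hne : V.non.Nonempty := by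
    obtain ⟨A, -, hA, -, -⟩ := exists_valuationSubring_ne_top_ne ℚ
    exact ⟨_, hnon _ ⟨⟨A, hA⟩, rfl⟩⟩
  obtain ⟨v₀, hv₀⟩ := hne
  -- complex conjugation, a nontrivial element of `G_ℚ`
  obtain ⟨c, hc⟩ := Literature.NumberTheory.GaloisRepresentations.exists_isComplexConjugation (Rat.castHom ℝ)
  have hc1 : c ≠ 1 := hc.ne_one
  -- two endomorphisms of `Q` over the identity of `V✠`
  have mk : ∀ σ : absoluteGaloisGroup ℚ, ∃ φ : PanalocalTPair.Hom (fieldShadowVocabulary F) Q Q,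
      φ.φV = PanalocalGaloisTheater.Hom.refl V ∧ ∀ v, φ.φnon v = fieldAutHom σ := fun σ =>
    ⟨{ φV := PanalocalGaloisTheater.Hom.refl V
       φnon := fun _ => fieldAutHom σ
       φnon_equivariant := fun v g => by
         change (Iso.refl _).hom ≫ (fieldAutHom σ).hom = (fieldAutHom σ).hom ≫ (Iso.refl _).hom
         rw [Iso.refl_hom, Category.id_comp, Category.comp_id]
       φarc := fun _ => Iso.refl _
       φarc_kummer := fun v => by
         exact kummerTransportTF_refl (X := V.X v) (M := CommRingCat.of (AlgebraicClosure ℚ)) (κ v) },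
      rfl, fun _ => rfl⟩
  obtain ⟨φ₁, h₁, h₁'⟩ := mk 1
  obtain ⟨φ₂, h₂, h₂'⟩ := mk c
  have heq : φ₁ = φ₂ := h Q Q φ₁ φ₂ (h₁.trans h₂.symm)
  have hn : fieldAutHom (1 : absoluteGaloisGroup ℚ) = fieldAutHom c := by
    rw [← h₁' ⟨v₀, hv₀⟩, ← h₂' ⟨v₀, hv₀⟩, heq]
  apply hc1
  refine (gal_eq_of_forall_smul_eq fun x => ?_).symm
  have hx := congrArg (fun e : (CommRingCat.of (AlgebraicClosure ℚ) : CommRingCat.{0}) ≅ _ => e.hom.hom x) hn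
  exact hx

end NumberFieldShadow

end Literature.AnabelianGeometry.AbsoluteAnabelian

end
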